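import Summits.ResolutionOfSingularities.ResolutionOfSingularities.Theorems.FrobeniusClosingSteerLogFrameNormalForm
import Summits.ResolutionOfSingularities.ResolutionOfSingularities.Theorems.FrobeniusClosingSteerContentFrameLocAtCentre
import Summits.ResolutionOfSingularities.ResolutionOfSingularities.Theorems.FrobeniusClosingSteerCore4SteeredRunExists
import Mathlib.FieldTheory.KummerPolynomial
import Mathlib.FieldTheory.IntermediateField.Algebraic
import Mathlib.FieldTheory.IntermediateField.Adjoin.Basic
import HarnessLib

/-!
# Crux `Steer` (stmt-ResolutionOfSingularities-16345), chain W4.1 — idea-2's dictionary **DICT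
# `SimpleIsLogFinal`** (the F-LU ∧ DICT split of the plan for `stub_nonSwitchingCore`): a SIMPLE point of
# `d(t ^ p)`, `t ^ p` not a `p`-th power, is LOG-FINAL — indeed always of type E2 (exchanged radicand TOROIDAL
# with an exponent equal to `1`). LEAF.

OURS (campaign `res-hironaka`, rung L, slot W4.1, chain W4.1; seat res-D-pv-007 AS res-L0-w41-stub-5; replaces
the role of no printed item; NOT a statement of the manuscript under review [claim: Hironaka2017, status:
under-review]; AI-produced, weaker than expert review). Theses-free and definition-free: the skeleton's and
res-L0-w41-idea-2's vocabulary (`IsFracOf`, `ZeroDim`, `IsLogDer`, `LogElementaryAt`, `ToroidalAt`,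
`ContentInvertible`, `LogFinalAt`, Sketch-idea-2c.lean §Split) is UNFOLDED into binders.

## Statement (`LogFinal.simpleIsLogFinal`)

res-L0-w41-idea-2's `Idea2g3.SimpleIsLogFinal p` VERBATIM with ONE added binder — `ZeroDim k O` after
`A₁.toSubring ≤ O.toSubring`, exactly as the registered `LogFinalExitM` gained it in r18 (closed centre: the residue
field of `locAtCentre A₁ O` is algebraic over the perfect `k`, hence perfect, so Kunz's `p`-basis LIB-03 applies;
composition-neutral since `foliationLUR1M_of_split` runs under the F-LU binders, which contain `ZeroDim k O`).
For `k` perfect of characteristic `p`, `A₀ ≤ A₁ ⊆ O` finitely generated `k`-subalgebras of the valued field `(K, O)`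
with `A₁ ⊆ Frac A₀`, `t ^ p ∈ A₀` not a `p`-th power in the local ring of `A₀` at the centre (regular), and
`S := locAtCentre A₁ O` regular: IF `t ^ p` has a SIMPLE (log-elementary) point at `S` — a boundary `z` (part of a
regular system of parameters of `S`) and `h ≠ 0` with `h ∏ z ∣ δ (t^p)` for every logarithmic derivation `δ`
(`z j ∣ δ (z j)`) and `δ₀ (t^p) = h ∏ z · unit` for one of them — THEN `S` is log-final for `t`; the proof always
produces the E2 disjunct: an exchanged radicand `t₂ ∈ K`, not a fraction of elements of `A₀`, with `t₂ ^ p`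
toroidal in `S` with an exponent `1`.

## Proof

* `LogFrame.exists_normalForm` (pieces 1–4: log frame `μ_p^{s'} × α_p^{n-1-s'}` of `ker (d f / h∏z)`,
  `α_p`-projection, `μ_p`-weights, exchange, Kunz reading) at `S` — whose Kunz prerequisites (perfect residue
  field, F-finiteness, dual derivations of a regular system of parameters extending `z`, determination of
  `Der_ℤ(S)` by it) are res-L0-w41-stub-9's `ContentFrame.derivation_eq_zero_locAtCentre` /
  `PfaffLine.exists_dual_derivations_locAtCentre` / LIB-03: `D ^ p · t ^ p = ∑_{k<p} e_k ^ p w₀ ^ k` in `S` with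
  `w₀ = ∏ Y i ^ ν i`, `Y` a regular system of parameters, `ν m₀ = 1`, `D ≠ 0`.
* `exists_pow_eq_of_sum_pow` (FIELD STEP in `K`, `F := Frac A₀ ⊇ S`, `Fp := F^p`): `t ^ p ∈ Fp⟮w₀⟯`; `w₀ ∉ Fp`
  (`not_pow_eq_prod_pow`: the `Y m₀`-adic valuation, normality of `S`) and `t ^ p ∉ Fp` (`t ∉ F`,
  `SteeredRun.not_mem_closure_of_ne_pow`); both simple extensions have degree `p`
  (`X_pow_sub_C_irreducible_iff_of_prime`), so `Fp⟮t^p⟯ = Fp⟮w₀⟯ ≤ K^p`: `w₀ = t₂ ^ p`, `t₂ ∉ F`.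

[cite: Kunz1969, Thm. 2.1] [cite: Matsumura1987, §25, §30, Thm. 19.4] [folklore]
-/

noncomputable section

-- `Summit.<S>.<S>.…` duplicates the summit name by design (single-problem summit).
set_option linter.dupNamespace false
set_option autoImplicit false

namespace Summit.ResolutionOfSingularities.ResolutionOfSingularities.Theorems.SwitchingDichotomy

namespace LogFinal

open IsLocalRing Polynomial IntermediateField
open Literature.AlgebraicGeometry.Resolution
open Literature.AlgebraicGeometry.Hironaka2017.S02Preliminaries

/-! ## §1 The field step: `D ^ p f = ∑ e_k ^ p w₀ ^ k` with `f, w₀ ∉ F^p`, `f ∈ K^p` ⇒ `w₀ ∈ K^p` -/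

section FieldStep

variable {K : Type*} [Field K] (p : ℕ) [Fact p.Prime] [CharP K p]

/-- **Field step.** `F ⊆ K` a subfield, `f, w₀, D, e k ∈ F`, `D ≠ 0`, `D ^ p * f = ∑_k (e k) ^ p * w₀ ^ k`,
neither `f` nor `w₀` a `p`-th power of an element of `F`, and `f = t ^ p` a `p`-th power in `K`. Then `w₀ = t₂ ^ p`
for some `t₂ ∈ K ∖ F`: inside `K`, `Fp⟮f⟯ ≤ Fp⟮w₀⟯` are simple extensions of `Fp := F^p` of the same prime degree `p`
(Kummer: `X ^ p - a` is irreducible iff `a` is not a `p`-th power), hence equal, and `Fp⟮f⟯ ≤ K^p`. [folklore] -/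
theorem exists_pow_eq_of_sum_pow (F : Subfield K) {f w₀ D t : K} {N : ℕ} (e : Fin N → K)
    (hf : f ∈ F) (hw₀ : w₀ ∈ F) (hD : D ∈ F) (hD0 : D ≠ 0) (he : ∀ k, e k ∈ F)
    (hrel : D ^ p * f = ∑ k, (e k) ^ p * w₀ ^ (k : ℕ)) (ht : t ^ p = f)
    (hfF : ∀ x ∈ F, x ^ p ≠ f) (hwF : ∀ x ∈ F, x ^ p ≠ w₀) :
    ∃ t₂ : K, t₂ ^ p = w₀ ∧ t₂ ∉ F := by
  classical
  have hp : p.Prime := Fact.out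
  haveI : ExpChar K p := ExpChar.prime hp
  -- `Fp := F^p`
  set Fp : Subfield K := F.map (frobenius K p) with hFpdef
  have hFp : ∀ x, x ∈ Fp ↔ ∃ y ∈ F, y ^ p = x := fun x => by
    rw [hFpdef, Subfield.mem_map]
    simp only [frobenius_def]
  have hpow : ∀ x ∈ F, x ^ p ∈ Fp := fun x hx => (hFp _).mpr ⟨x, hx, rfl⟩
  have hfFp : f ∉ Fp := fun h => by
    obtain ⟨y, hy, hyp⟩ := (hFp f).mp h
    exact hfF y hy hyp
  have hwFp : w₀ ∉ Fp := fun h => by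
    obtain ⟨y, hy, hyp⟩ := (hFp w₀).mp h
    exact hwF y hy hyp
  -- integrality and degree `p` of `a ∈ F ∖ Fp` over `Fp`
  have hint : ∀ a : K, a ∈ F → IsIntegral Fp a := fun a haF =>
    IsIntegral.of_pow hp.pos (by
      rw [show a ^ p = algebraMap Fp K ⟨a ^ p, hpow a haF⟩ from rfl]
      exact isIntegral_algebraMap)
  have hdeg : ∀ a : K, ∀ haF : a ∈ F, a ∉ Fp → Module.finrank Fp Fp⟮a⟯ = p := by
    intro a haF haFp
    have hirr : Irreducible (X ^ p - C (⟨a ^ p, hpow a haF⟩ : Fp)) := by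
      refine (X_pow_sub_C_irreducible_iff_of_prime hp).mpr fun b hb => ?_
      have h1 : ((b : K)) ^ p = a ^ p := by
        have := congrArg (fun x : Fp => (x : K)) hb
        simpa using this
      have h2 : (b : K) = a := frobenius_inj K p h1
      exact haFp (h2 ▸ b.2)
    have hmin : minpoly Fp a = X ^ p - C (⟨a ^ p, hpow a haF⟩ : Fp) := by
      refine (minpoly.eq_of_irreducible_of_monic hirr ?_ (monic_X_pow_sub_C _ hp.ne_zero)).symm
      rw [map_sub, aeval_X_pow, aeval_C]
      exact sub_eq_zero.mpr rfl
    rw [adjoin.finrank (hint a haF), hmin, natDegree_X_pow_sub_C]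
  -- `f ∈ Fp⟮w₀⟯`
  have halg : ∀ x : K, x ∈ Fp → x ∈ Fp⟮w₀⟯ := fun x hx => (Fp⟮w₀⟯).algebraMap_mem ⟨x, hx⟩
  have hmem : f ∈ Fp⟮w₀⟯ := by
    have hDp : (D ^ p : K) ≠ 0 := pow_ne_zero _ hD0
    have h1 : f = (D ^ p)⁻¹ * ∑ k, (e k) ^ p * w₀ ^ (k : ℕ) := by
      rw [← hrel, ← mul_assoc, inv_mul_cancel₀ hDp, one_mul]
    rw [h1]
    refine mul_mem (inv_mem (halg _ (hpow D hD))) (sum_mem fun k _ => ?_)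
    exact mul_mem (halg _ (hpow _ (he k))) (pow_mem (mem_adjoin_simple_self Fp w₀) _)
  -- the two simple extensions coincide
  have hle : Fp⟮f⟯ ≤ Fp⟮w₀⟯ := adjoin_simple_le_iff.mpr hmem
  haveI : FiniteDimensional Fp Fp⟮w₀⟯ := adjoin.finiteDimensional (hint w₀ hw₀)
  have heq : Fp⟮f⟯ = Fp⟮w₀⟯ :=
    eq_of_le_of_finrank_eq hle (by rw [hdeg f hf hfFp, hdeg w₀ hw₀ hwFp])
  have hw₀mem : w₀ ∈ Fp⟮f⟯ := by
    rw [heq]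
    exact mem_adjoin_simple_self Fp w₀
  -- `Fp⟮f⟯ ≤ K^p`
  let Kp : IntermediateField Fp K := (frobenius K p).fieldRange.toIntermediateField fun x => by
    obtain ⟨y, -, hyx⟩ := (hFp x).mp x.2
    exact RingHom.mem_fieldRange.mpr ⟨y, hyx⟩
  have hfKp : f ∈ Kp := RingHom.mem_fieldRange.mpr ⟨t, ht⟩
  have hle2 : Fp⟮f⟯ ≤ Kp := adjoin_simple_le_iff.mpr hfKp
  have hw₀Kp : w₀ ∈ (frobenius K p).fieldRange := hle2 hw₀mem
  obtain ⟨t₂, ht₂⟩ := RingHom.mem_fieldRange.mp hw₀Kp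
  exact ⟨t₂, ht₂, fun h => hwF t₂ h ht₂⟩

end FieldStep

/-! ## §2 A monomial with an exponent `1` is not a `p`-th power -/

section NotPow

variable {A : Type*} [CommRing A] [IsDomain A] [IsLocalRing A]

/-- In a regular local ring, `∏ i, y i ^ ν i` with `y` part of a regular system of parameters and `ν m₀ = 1` is
not a `p`-th power (`p ≥ 2`): the prime `y m₀` would divide some other `y i`.
[cite: Matsumura1987, Thm. 14.2, Thm. 20.3 (regular ⇒ UFD)] [folklore] -/
theorem not_pow_eq_prod_pow {n : ℕ} (y : Fin n → A) (hz : IsRsopPart y) (ν : Fin n → ℕ) (m₀ : Fin n)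
    (hν : ν m₀ = 1) {p : ℕ} (hp : 2 ≤ p) (c : A) : c ^ p ≠ ∏ i, y i ^ ν i := by
  classical
  intro hc
  have hprime : Prime (y m₀) := hz.prime m₀
  have hsplit : ∏ i, y i ^ ν i = y m₀ * ∏ i ∈ Finset.univ.erase m₀, y i ^ ν i := by
    rw [← Finset.mul_prod_erase _ _ (Finset.mem_univ m₀), hν, pow_one]
  -- `y m₀ ∣ c`
  have hdvd : y m₀ ∣ c := hprime.dvd_of_dvd_pow ⟨_, hc.trans hsplit⟩
  obtain ⟨c', rfl⟩ := hdvd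
  -- cancel one `y m₀`: `y m₀ ^ (p - 1) * c' ^ p = ∏_{i ≠ m₀} y i ^ ν i`
  obtain ⟨q, hq⟩ : ∃ q, p = q + 2 := ⟨p - 2, (Nat.sub_add_cancel hp).symm⟩
  have hrest : y m₀ * (y m₀ ^ (q + 1) * c' ^ p) = y m₀ * ∏ i ∈ Finset.univ.erase m₀, y i ^ ν i := by
    rw [← hsplit, ← hc, hq]; ring
  have hrest' := mul_left_cancel₀ (hz.ne_zero m₀) hrest
  have hdvd' : y m₀ ∣ ∏ i ∈ Finset.univ.erase m₀, y i ^ ν i :=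
    ⟨y m₀ ^ q * c' ^ p, by rw [← hrest']; ring⟩
  obtain ⟨i, hi, hyi⟩ := hprime.exists_mem_finset_dvd hdvd'
  exact hz.not_dvd (Ne.symm (Finset.mem_erase.mp hi).1) (hprime.dvd_of_dvd_pow hyi)

end NotPow

/-! ## §3 The leaf at `S = locAtCentre A₁ O` -/

section Leaf

variable {k K : Type} [Field k] [Field K] [Algebra k K]

/-- Kunz prerequisites at `S = (A₁)_{𝔪_O ∩ A₁}`: `k` perfect of characteristic `p`, `A₁` finitely generated, `O`
zero-dimensional over `k` ⇒ the residue field of `S` is perfect and `S` is F-finite at level `1`.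
[cite: Kunz1969, §1–2] [folklore] -/
theorem perfectField_and_isFFinite_locAtCentre (p : ℕ) [Fact p.Prime] [CharP k p] [PerfectField k]
    (O : ValuationSubring K) (A₁ : Subalgebra k K) (h₁ : A₁.toSubring ≤ O.toSubring) (hfg : A₁.FG)
    (hzd : ∀ x ∈ O, ∃ g : k[X], g ≠ 0 ∧ aeval x g ∈ O.nonunits)
    [IsLocalRing (locAtCentre A₁.toSubring O)] :
    PerfectField (ResidueField (locAtCentre A₁.toSubring O)) ∧ IsFFinite p 1 (locAtCentre A₁.toSubring O) := by
  classical
  letI algA : Algebra k A₁.toSubring := A₁.algebra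
  haveI : Algebra.FiniteType k A₁.toSubring := (Subalgebra.fg_iff_finiteType A₁).mp hfg
  letI algS : Algebra k (locAtCentre A₁.toSubring O) :=
    ((algebraMap A₁.toSubring (locAtCentre A₁.toSubring O)).comp (algebraMap k A₁.toSubring)).toAlgebra
  haveI : IsScalarTower k A₁.toSubring (locAtCentre A₁.toSubring O) :=
    IsScalarTower.of_algebraMap_eq fun _ => rfl
  haveI : IsScalarTower k (locAtCentre A₁.toSubring O) K := IsScalarTower.of_algebraMap_eq fun _ => rfl
  haveI := isLocalization_locAtCentre (B := A₁.toSubring) (O := O) h₁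
  haveI : Algebra.EssFiniteType A₁.toSubring (locAtCentre A₁.toSubring O) :=
    Algebra.EssFiniteType.of_isLocalization (locAtCentre A₁.toSubring O)
      (subringCentre A₁.toSubring O h₁).primeCompl
  haveI : Algebra.EssFiniteType k (locAtCentre A₁.toSubring O) :=
    Algebra.EssFiniteType.comp k A₁.toSubring (locAtCentre A₁.toSubring O)
  haveI : CharP (locAtCentre A₁.toSubring O) p := charP_of_algebra_field k p
  haveI : ExpChar k p := ExpChar.prime (Fact.out : p.Prime)
  haveI : PerfectRing k p := PerfectField.toPerfectRing p
  haveI : Algebra.IsAlgebraic k (ResidueField (locAtCentre A₁.toSubring O)) := by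
    refine ⟨fun r => ?_⟩
    obtain ⟨s, rfl⟩ := residue_surjective r
    obtain ⟨g, hg0, hg⟩ := hzd (s : K) (locAtCentre_le h₁ s.2)
    refine ⟨g, hg0, ?_⟩
    have hgs : aeval s g ∈ maximalIdeal (locAtCentre A₁.toSubring O) := by
      rw [mem_maximalIdeal_locAtCentre_iff h₁, ← ValuationSubring.mem_nonunits_iff]
      have hK : ((aeval s g : locAtCentre A₁.toSubring O) : K) = aeval (s : K) g := by
        rw [show ((aeval s g : locAtCentre A₁.toSubring O) : K) =
            algebraMap (locAtCentre A₁.toSubring O) K (aeval s g) from rfl, ← aeval_algebraMap_apply]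
        rfl
      rw [hK]
      exact hg
    rw [show residue (locAtCentre A₁.toSubring O) s =
        algebraMap (locAtCentre A₁.toSubring O) (ResidueField (locAtCentre A₁.toSubring O)) s from rfl,
      aeval_algebraMap_apply]
    exact (residue_eq_zero_iff _).mpr hgs
  exact ⟨Algebra.IsAlgebraic.perfectField k, isFFinite_of_essFiniteType (𝕂 := k) p 1⟩

/-- **DICT (`SimpleIsLogFinal`, with the r18 binder `ZeroDim k O`).** See the module docstring: a simple
(log-elementary) point of `d(t ^ p)` on a finitely generated regular model `A₁ ⊆ Frac A₀` dominated by `O`, with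
`t ^ p` not a `p`-th power at the centre of `A₀`, is log-final — via the E2 disjunct. res-L0-w41-idea-2's
`Idea2g3.SimpleIsLogFinal p` (Sketch-idea-2c.lean §Split) with every predicate unfolded and `ZeroDim k O` inserted
after `A₁.toSubring ≤ O.toSubring`. [cite: Kunz1969, Thm. 2.1] [cite: Matsumura1987, §25, §30, Thm. 19.4]
[folklore] -/
theorem simpleIsLogFinal (p : ℕ) :
    ∀ (k K : Type) [Field k] [CharP k p] [PerfectField k] [Field K] [Algebra k K]
      (O : ValuationSubring K) (A₀ A₁ : Subalgebra k K) (h₀ : A₀.toSubring ≤ O.toSubring) (t : K),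
      p.Prime → A₀.FG → ∀ (htp : t ^ p ∈ A₀), IsFractionRing (Algebra.adjoin k (insert t (A₀ : Set K))) K →
      IsRegularLocalRing
        (Localization.AtPrime (Ideal.comap (Subring.inclusion h₀) (IsLocalRing.maximalIdeal O))) →
      (∀ c : Localization.AtPrime (Ideal.comap (Subring.inclusion h₀) (IsLocalRing.maximalIdeal O)),
        algebraMap A₀.toSubring (Localization.AtPrime (Ideal.comap (Subring.inclusion h₀)
          (IsLocalRing.maximalIdeal O))) ⟨t ^ p, htp⟩ ≠ c ^ p) →
      A₀ ≤ A₁ → A₁.FG → (∀ x ∈ A₁, ∃ y ∈ A₀, ∃ z ∈ A₀, z ≠ 0 ∧ x = y / z) → A₁.toSubring ≤ O.toSubring →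
      (∀ x ∈ O, ∃ g : Polynomial k, g ≠ 0 ∧ Polynomial.aeval x g ∈ O.nonunits) →
      ∀ (_ : IsLocalRing (locAtCentre A₁.toSubring O)),
        IsRegularLocalRing (locAtCentre A₁.toSubring O) →
        (∃ f' : locAtCentre A₁.toSubring O, (f' : K) = t ^ p ∧
          ∃ (s : ℕ) (z : Fin s → locAtCentre A₁.toSubring O), IsRsopPart z ∧
            ∃ h : locAtCentre A₁.toSubring O, h ≠ 0 ∧
              (∀ δ : Derivation ℤ (locAtCentre A₁.toSubring O) (locAtCentre A₁.toSubring O),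
                (∀ j, z j ∣ δ (z j)) → h * (∏ j, z j) ∣ δ f') ∧
              ∃ δ : Derivation ℤ (locAtCentre A₁.toSubring O) (locAtCentre A₁.toSubring O),
                (∀ j, z j ∣ δ (z j)) ∧ ∃ u : locAtCentre A₁.toSubring O, IsUnit u ∧
                  δ f' = h * (∏ j, z j) * u) →
        ((∃ f' : locAtCentre A₁.toSubring O, (f' : K) = t ^ p ∧
            ∃ h : locAtCentre A₁.toSubring O, h ≠ 0 ∧
              (∀ δ : Derivation ℤ (locAtCentre A₁.toSubring O) (locAtCentre A₁.toSubring O), h ∣ δ f') ∧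
              ∃ (δ : Derivation ℤ (locAtCentre A₁.toSubring O) (locAtCentre A₁.toSubring O))
                (u : locAtCentre A₁.toSubring O), IsUnit u ∧ δ f' = h * u) ∨
          (∃ t₂ : K, ¬ (∃ y ∈ A₀, ∃ z ∈ A₀, z ≠ 0 ∧ t₂ = y / z) ∧
            ∃ (s : ℕ) (z : Fin s → locAtCentre A₁.toSubring O), IsRsopPart z ∧
              ∃ (m : Fin s → ℕ), (∃ l, ¬ p ∣ m l) ∧
                ∃ u : locAtCentre A₁.toSubring O, IsUnit u ∧
                  t₂ ^ p = (∏ l, ((z l : locAtCentre A₁.toSubring O) : K) ^ m l) * (u : K))) := by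
  intro k K _ _ _ _ _ O A₀ A₁ h₀ t hp hfg₀ htp _ hreg₀ hnp hle hfg₁ hfrac h₁ hzd _ hregS hlog
  classical
  haveI : Fact p.Prime := ⟨hp⟩
  haveI : CharP K p := charP_of_injective_algebraMap (algebraMap k K).injective p
  haveI := hregS
  haveI : CharP (locAtCentre A₁.toSubring O) p := ContentFrame.charP_locAtCentre p O A₁
  haveI := isDomain_of_isRegularLocalRing (R := locAtCentre A₁.toSubring O)
  obtain ⟨f', hf', s, z, hz, h, hh, hdiv, δ₀, hδ₀, u, hu, hδ₀f⟩ := hlog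
  -- Kunz prerequisites
  obtain ⟨hperf, hF⟩ := perfectField_and_isFFinite_locAtCentre p O A₁ h₁ hfg₁ hzd
  haveI := hperf
  -- a regular system of parameters `X` extending the boundary `z`, with dual derivations determining `Der`
  obtain ⟨e, X, hd, hX, hXz⟩ := hz.exists_rsop
  have hdim : ringKrullDim (locAtCentre A₁.toSubring O) = ((s + e : ℕ) : WithBot ℕ∞) := by
    rw [← IsRegularLocalRing.spanFinrank_maximalIdeal, hd]
  obtain ⟨Δ, hdual⟩ :=
    PfaffLine.exists_dual_derivations_locAtCentre p k K O A₁ h₁ hfg₁ X hX hdim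
  have hdet : ∀ δ : Derivation ℤ (locAtCentre A₁.toSubring O) (locAtCentre A₁.toSubring O),
      (∀ i, δ (X i) = 0) → δ = 0 :=
    fun δ hδ => ContentFrame.derivation_eq_zero_locAtCentre p O A₁ h₁ hfg₁ hzd X hX δ hδ
  -- the boundary as a set of indices of `X`
  let J : Finset (Fin (s + e)) := Finset.univ.image (Fin.castAdd e)
  have hJ : ∀ {j}, j ∈ J → ∃ j', j = Fin.castAdd e j' := fun {j} hj => by
    obtain ⟨j', -, rfl⟩ := Finset.mem_image.mp hj
    exact ⟨j', rfl⟩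
  have hlog_of : ∀ θ : Derivation ℤ (locAtCentre A₁.toSubring O) (locAtCentre A₁.toSubring O),
      (∀ j ∈ J, X j ∣ θ (X j)) → ∀ j', z j' ∣ θ (z j') := by
    intro θ hθ j'
    have h1 := hθ (Fin.castAdd e j') (Finset.mem_image.mpr ⟨j', Finset.mem_univ _, rfl⟩)
    rwa [hXz] at h1
  have hq : h * ∏ j, z j ≠ 0 := mul_ne_zero hh (Finset.prod_ne_zero_iff.mpr fun j _ => hz.ne_zero j)
  -- ### the normal form `D ^ p f' = ∑ e_k ^ p w₀ ^ k`
  obtain ⟨Y, ν, m₀, D, ec, hY, hνm₀, hD0, hrel⟩ :=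
    LogFrame.exists_normalForm p hF X hX hd Δ hdual hdet J hq
      (fun θ hθ => hdiv θ (hlog_of θ hθ)) δ₀
      (fun j hj => by
        obtain ⟨j', rfl⟩ := hJ hj
        rw [hXz]
        exact hδ₀ j')
      hu hδ₀f
  have hn : (maximalIdeal (locAtCentre A₁.toSubring O)).spanFinrank = s + e := hd
  have hzY : IsRsopPart Y := by simpa using isRsopPart_comp_of_rsop hn Y hY id Function.injective_id
  -- ### the field step
  set F : Subfield K := Subfield.closure (A₀ : Set K) with hFdef
  have hA₁F : ((A₁.toSubring : Subring K) : Set K) ⊆ F := by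
    intro x hx
    obtain ⟨y, hy, w, hw, -, rfl⟩ := hfrac x hx
    exact F.div_mem (Subfield.subset_closure hy) (Subfield.subset_closure hw)
  have hSF : ∀ x : locAtCentre A₁.toSubring O, (x : K) ∈ F := fun x =>
    SteeredRun.locAtCentre_subset_subfield O hA₁F x.2
  have htF : t ∉ F := SteeredRun.not_mem_closure_of_ne_pow O A₀ h₀ hp.ne_zero t htp hreg₀ hnp
  set w₀ : locAtCentre A₁.toSubring O := ∏ i, Y i ^ ν i with hw₀
  -- `w₀` is not a `p`-th power of an element of `F`
  haveI : IsIntegrallyClosed (locAtCentre A₁.toSubring O) :=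
    isIntegrallyClosed_of_isRegularLocalRing (locAtCentre A₁.toSubring O)
  have hwF : ∀ x ∈ F, x ^ p ≠ (w₀ : K) := by
    intro x hx hxp
    obtain ⟨y, hy, w, hw, hyw⟩ := Subfield.mem_closure_iff.mp hx
    have hyA : y ∈ A₀.toSubring := (Subring.closure_le (t := A₀.toSubring)).mpr (fun _ h => h) hy
    have hwA : w ∈ A₀.toSubring := (Subring.closure_le (t := A₀.toSubring)).mpr (fun _ h => h) hw
    have hA₀S : ∀ a ∈ A₀, a ∈ locAtCentre A₁.toSubring O :=
      fun a ha => le_locAtCentre A₁.toSubring O (hle ha)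
    have hw₀0 : (w₀ : K) ≠ 0 := by
      have h0 : w₀ ≠ 0 := Finset.prod_ne_zero_iff.mpr fun i _ => pow_ne_zero _ (hzY.ne_zero i)
      exact fun h' => h0 (Subtype.ext h')
    by_cases hw0 : w = 0
    · refine hw₀0 ?_
      rw [← hxp, ← hyw, hw0, div_zero, zero_pow hp.ne_zero]
    · set yL : locAtCentre A₁.toSubring O := ⟨y, hA₀S y hyA⟩ with hyL
      set wL : locAtCentre A₁.toSubring O := ⟨w, hA₀S w hwA⟩ with hwL
      have hdvd : wL ^ p ∣ yL ^ p := by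
        refine ⟨w₀, Subtype.ext ?_⟩
        change y ^ p = w ^ p * (w₀ : K)
        rw [← hxp, ← hyw, div_pow, mul_div_cancel₀ _ (pow_ne_zero _ hw0)]
      obtain ⟨c, hc1⟩ := (IsIntegrallyClosed.pow_dvd_pow_iff hp.ne_zero).mp hdvd
      have hyc : y = w * (c : K) := by
        have := congrArg (fun v : locAtCentre A₁.toSubring O => (v : K)) hc1
        simpa using this
      have hxc : x = (c : K) := by rw [← hyw, hyc, mul_div_cancel_left₀ _ hw0]
      refine not_pow_eq_prod_pow Y hzY ν m₀ hνm₀ hp.two_le c (Subtype.ext ?_)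
      change ((c ^ p : locAtCentre A₁.toSubring O) : K) = (w₀ : K)
      rw [SubmonoidClass.coe_pow, ← hxc, hxp]
  -- `t ^ p` is not a `p`-th power of an element of `F` (`t ∉ F`)
  haveI : ExpChar K p := ExpChar.prime hp
  have hfF : ∀ x ∈ F, x ^ p ≠ (f' : K) := by
    intro x hx hxp
    rw [hf'] at hxp
    exact htF ((frobenius_inj K p hxp : x = t) ▸ hx)
  have hD0K : ((D : locAtCentre A₁.toSubring O) : K) ≠ 0 := fun h' => hD0 (Subtype.ext h')
  have hrelK := congrArg ((locAtCentre A₁.toSubring O).subtype) hrel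
  simp only [map_mul, map_pow, map_sum] at hrelK
  obtain ⟨t₂, ht₂, ht₂F⟩ := exists_pow_eq_of_sum_pow p F (fun kk => ((ec kk : locAtCentre A₁.toSubring O) : K))
    (hSF f') (hSF w₀) (hSF D) hD0K (fun kk => hSF (ec kk)) hrelK hf'.symm hfF hwF
  -- ### E2
  refine Or.inr ⟨t₂, ?_, s + e, Y, hzY, ν, ⟨m₀, ?_⟩, 1, isUnit_one, ?_⟩
  · rintro ⟨y, hy, w, hw, -, rfl⟩
    exact ht₂F (F.div_mem (Subfield.subset_closure hy) (Subfield.subset_closure hw))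
  · rw [hνm₀, Nat.dvd_one]
    exact hp.ne_one
  · rw [ht₂, hw₀, OneMemClass.coe_one, mul_one, SubmonoidClass.coe_finsetProd]
    exact Finset.prod_congr rfl fun l _ => by rw [SubmonoidClass.coe_pow]

end Leaf

end LogFinal

end Summit.ResolutionOfSingularities.ResolutionOfSingularities.Theorems.SwitchingDichotomy
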